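import Summits.HodgeConjecture.HodgeConjecture.Theorems.F0P3SpectralPacketHTraceOn   -- «FILE 3h″» §§1–4 (LH7-typ2 (g3)): `UnramTraceOneHOff`, `trHOn`, `PresentationIndepHOn`, `presentationIndepHOn_of_admissible`
import HarnessLib

/-!
# (N) DEFS, FILE 3h″ §5 — THE FEED FROM THE HUR-GUARDED KIT-LAW ROW (KH3′)♭ TO (TF-1)-H∕S₀ `UnramTraceOneHOff S₀` (split from `F0P3SpectralPacketHTraceOn` for the gate's 400-line lint)
# (Rogawski §13.3 p. 203 l. 1–3; §4.3 p. 44; §4.5 p. 49)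

Cell `hodgecm-mathlib` (D-0151), F0∕P3 «U3-mult», crux H413 (`stmt-HodgeConjecture-24833`), route of record `HCCMUnconditional`; F13 «JQ-RAM» (director M-159∕b∕c; R90-TF LEAD
K2E1-plan (g8) LEAD #43 (B) = F13-SCOPE §3′ r3; heir LEAD F0P3a-plan (g22) T21-16 (R-41), T21-17 W0).  Author LH7-typ2 (g3) (cand v2 8851ac3765b35ff4 §5, bytes unchanged); filed by the
prover seat R90-C146-p01 (g2) (D-0016).  PROOF lane (`--supports stmt-HodgeConjecture-24833 --as helper`): theorems only; no `def`, no instance, no notation, no named fact, no `sorry`.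

CONTENTS (§5 of the author's cand, verbatim): `isUnramifiedIn_of_not_mem_of_ramified_subset` (off any finite `S₀ ⊇ RamL` a place is unramified in `L∕L⁺`);
`SpectralPacketH.UnramTraceOneHOff.of_forall_isUnramifiedIn` ∕ `.of_isUnramifiedIn` ∕ `.of_isUnramifiedIn_of_prod` ∕ `.of_isUnramifiedIn_of_ramified_subset` ∕
`.of_isUnramifiedIn_of_prod_of_ramified_subset` — from the (KH3′)♭ row's kernel `∀ v, Algebra.IsUnramifiedIn (𝓞 L) v.asIdeal → unr → Tr 1_{K₂×K₁} = vol` + `hvolH` + the (α‴) arrow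
`∀ v ∉ S₀, Algebra.IsUnramifiedIn (𝓞 L) v.asIdeal` to `ρ.UnramTraceOneHOff S₀ νH` (T-B W4 :189 = ONE by-name line).

HONEST LABEL: count-neutral repair lemmas; HC_CM is proved only modulo the 7 printed citations (2 remaining named inputs: hLiu418 = stmt-HodgeConjecture-24832, h413 =
stmt-HodgeConjecture-24833) until rung 0 closes; STANDING DEFECT M-159∕b∕c «JQ-RAM» until F13 №2 is BUILT.
-/

set_option autoImplicit false
-- the mandated namespace repeats `HodgeConjecture.HodgeConjecture`, as in every `Theorems/*.lean` of this sub-problem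
set_option linter.dupNamespace false

noncomputable section

open NumberField IsDedekindDomain MeasureTheory Filter
open scoped Matrix MatrixGroups

open Literature.NumberTheory Literature.NumberTheory.Automorphic Literature.NumberTheory.Automorphic.UnitaryGroup
open Literature.NumberTheory.Rogawski1990 Literature.NumberTheory.GaloisRepresentations
open Literature.RepresentationTheory.BorelWallach2000 Literature.RepresentationTheory.KonnoKonno2007
open Summit.HodgeConjecture.HodgeConjecture.Cruxes.H413.F0P3InnerFormClassificationV6 (TestH splitForm)
open Summit.HodgeConjecture.HodgeConjecture.Cruxes.H413.F0P3LocalPacketKit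
open Summit.HodgeConjecture.HodgeConjecture.Cruxes.H413.F0P3ArchPacketKit

namespace Summit.HodgeConjecture.HodgeConjecture.Cruxes.H413.F0P3SpectralPacket

open Summit.HodgeConjecture.HodgeConjecture.Cruxes.H413.F0P3GlobalPacket

variable {L : Type} [Field L] [NumberField L] [IsCMField L] {H' : Matrix (Fin 3) (Fin 3) L}
  {𝔩 : ∀ v : HeightOneSpectrum (𝓞 ↥(maximalRealSubfield L)), LocalPacketKit L H' v} {𝔞 : ArchPacketKit} {𝔞H : ArchPacketKitH 𝔞}
  {DiscH : GlobalPacketH 𝔩 → 𝔞H.PktInfH → Prop}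

/-! ## §5 The feed from the HUR-guarded kit-law row (KH3′)♭ [p. 203 l. 1–3; §4.3 p. 44; §4.5 p. 49] -/

omit [IsCMField L] in
/-- **OFF ANY FINITE `S₀ ⊇ RamL` A PLACE IS UNRAMIFIED IN `L/L⁺`** (`RamL := (finite_setOf_not_isUnramifiedIn L⁺ L).toFinset`, the finitely many places of `L⁺` ramified in `L`;
membership in `Set.Finite.toFinset`, as ★ `isUnramifiedIn_of_not_mem_ramifiedFinset`). [folklore] [cite: Rogawski1990, §4.5 p. 49] -/
theorem isUnramifiedIn_of_not_mem_of_ramified_subset {S₀ : Finset (HeightOneSpectrum (𝓞 ↥(maximalRealSubfield L)))}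
    (hS₀ : (Literature.NumberTheory.GaloisRepresentations.finite_setOf_not_isUnramifiedIn ↥(maximalRealSubfield L) L).toFinset ⊆ S₀)
    {v : HeightOneSpectrum (𝓞 ↥(maximalRealSubfield L))} (hv : v ∉ S₀) : Algebra.IsUnramifiedIn (𝓞 L) v.asIdeal :=
  not_not.1 fun h => hv (hS₀ ((Set.Finite.mem_toFinset _).2 h))

namespace SpectralPacketH

variable [∀ v : HeightOneSpectrum (𝓞 ↥(maximalRealSubfield L)), MeasurableSpace ((cmDatum L 2 (splitForm L 2)).Local v × (cmDatum L 1 (splitForm L 1)).Local v)]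
  {ρ : SpectralPacketH 𝔩 𝔞 𝔞H DiscH}
  {νH : ∀ v : HeightOneSpectrum (𝓞 ↥(maximalRealSubfield L)), Measure ((cmDatum L 2 (splitForm L 2)).Local v × (cmDatum L 1 (splitForm L 1)).Local v)}
  {S₀ : Finset (HeightOneSpectrum (𝓞 ↥(maximalRealSubfield L)))}

/-- **(TF-1)-H∕S₀ FROM A HUR-GUARDED (TF-1)-H**: if `Tr ρ_v(1_{K_{H,v}}) = 1` at every place `v` unramified in `L/L⁺` where `ξ_H(ρ_v)` is unramified, and every `v ∉ S₀` is
unramified in `L/L⁺`, then (TF-1)-H∕S₀. [cite: Rogawski1990, §13.3 p. 203 l. 1–3; §4.5 p. 49] -/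
theorem UnramTraceOneHOff.of_forall_isUnramifiedIn
    (h : ∀ v : HeightOneSpectrum (𝓞 ↥(maximalRealSubfield L)), Algebra.IsUnramifiedIn (𝓞 L) v.asIdeal → (𝔩 v).unr ((𝔩 v).xiH (ρ.fin.loc v)) →
      ρ.trFinAt v (νH v) ((((cmLocalIntegralLevel L 2 (splitForm L 2) v : Set ((cmDatum L 2 (splitForm L 2)).Local v)) ×ˢ
        (cmLocalIntegralLevel L 1 (splitForm L 1) v : Set ((cmDatum L 1 (splitForm L 1)).Local v)))).indicator fun _ => 1) = 1)
    (hS₀ : ∀ v ∉ S₀, Algebra.IsUnramifiedIn (𝓞 L) v.asIdeal) : ρ.UnramTraceOneHOff S₀ νH :=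
  fun v hv => h v (hS₀ v hv)

/-- **(TF-1)-H∕S₀ FROM THE ROW (KH3′)♭ OF THE TUPLE LETTERS** (T-A ED. 6 `TupleKitLawsK2`, the kernel shape of the row at `ρ`: «`Tr ρ_v(1_{K_{H,v}}) = vol_{νH_v}(K_{H,v})` at
every place `v` UNRAMIFIED IN `L/L⁺` where `ξ_H(ρ_v)` is unramified», ★ 3h-vol `UnramTraceVolH`'s text behind the guard `Algebra.IsUnramifiedIn (𝓞 L) v.asIdeal`) + the Haar
normalisation «`vol_{νH_v}(K_{H,v}) = 1`» (binder 34 `hvolH`, `.real` text) + «every `v ∉ S₀` is unramified in `L/L⁺`» (★ 3h-vol `UnramTraceVolH.unramTraceOneH` off `S₀`).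
[cite: Rogawski1990, §13.3 p. 203 l. 1–3; §4.3 p. 44; §4.5 p. 49] -/
theorem UnramTraceOneHOff.of_isUnramifiedIn
    (h : ∀ v : HeightOneSpectrum (𝓞 ↥(maximalRealSubfield L)), Algebra.IsUnramifiedIn (𝓞 L) v.asIdeal → (𝔩 v).unr ((𝔩 v).xiH (ρ.fin.loc v)) →
      ρ.trFinAt v (νH v) ((((cmLocalIntegralLevel L 2 (splitForm L 2) v : Set ((cmDatum L 2 (splitForm L 2)).Local v)) ×ˢ
        (cmLocalIntegralLevel L 1 (splitForm L 1) v : Set ((cmDatum L 1 (splitForm L 1)).Local v)))).indicator fun _ => 1) =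
        (νH v).real (((cmLocalIntegralLevel L 2 (splitForm L 2) v : Set ((cmDatum L 2 (splitForm L 2)).Local v)) ×ˢ
          (cmLocalIntegralLevel L 1 (splitForm L 1) v : Set ((cmDatum L 1 (splitForm L 1)).Local v)))))
    (hvolH : ∀ v : HeightOneSpectrum (𝓞 ↥(maximalRealSubfield L)),
      (νH v).real (((cmLocalIntegralLevel L 2 (splitForm L 2) v : Set ((cmDatum L 2 (splitForm L 2)).Local v)) ×ˢ
        (cmLocalIntegralLevel L 1 (splitForm L 1) v : Set ((cmDatum L 1 (splitForm L 1)).Local v)))) = 1)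
    (hS₀ : ∀ v ∉ S₀, Algebra.IsUnramifiedIn (𝓞 L) v.asIdeal) : ρ.UnramTraceOneHOff S₀ νH := fun v hv hunr => by
  rw [h v (hS₀ v hv) hunr, hvolH v, Complex.ofReal_one]

/-- **The same from THE WITNESS'S OWN normalisation text** «`νH_v ↑(K_{2,v}.prod K_{1,v}) = 1`» (ENNReal on the subgroup product, the field `Rung0WitnessS.hKH` ∕ the junction's
`hvolH` VERBATIM, as ★ 3h-vol `UnramTraceVolH.unramTraceOneH_of_prod`). [cite: Rogawski1990, §13.3 p. 203 l. 1–3; §4.3 p. 44; §4.5 p. 49] -/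
theorem UnramTraceOneHOff.of_isUnramifiedIn_of_prod
    (h : ∀ v : HeightOneSpectrum (𝓞 ↥(maximalRealSubfield L)), Algebra.IsUnramifiedIn (𝓞 L) v.asIdeal → (𝔩 v).unr ((𝔩 v).xiH (ρ.fin.loc v)) →
      ρ.trFinAt v (νH v) ((((cmLocalIntegralLevel L 2 (splitForm L 2) v : Set ((cmDatum L 2 (splitForm L 2)).Local v)) ×ˢ
        (cmLocalIntegralLevel L 1 (splitForm L 1) v : Set ((cmDatum L 1 (splitForm L 1)).Local v)))).indicator fun _ => 1) =
        (νH v).real (((cmLocalIntegralLevel L 2 (splitForm L 2) v : Set ((cmDatum L 2 (splitForm L 2)).Local v)) ×ˢ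
          (cmLocalIntegralLevel L 1 (splitForm L 1) v : Set ((cmDatum L 1 (splitForm L 1)).Local v)))))
    (hKH : ∀ v : HeightOneSpectrum (𝓞 ↥(maximalRealSubfield L)),
      νH v (((cmLocalIntegralLevel L 2 (Matrix.of fun i j : Fin 2 => if i.val + j.val + 1 = 2 then (1 : L) else 0) v).prod
          (cmLocalIntegralLevel L 1 (Matrix.of fun i j : Fin 1 => if i.val + j.val + 1 = 1 then (1 : L) else 0) v) :
            Subgroup ((cmDatum L 2 (splitForm L 2)).Local v × (cmDatum L 1 (splitForm L 1)).Local v)) :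
          Set ((cmDatum L 2 (splitForm L 2)).Local v × (cmDatum L 1 (splitForm L 1)).Local v)) = 1)
    (hS₀ : ∀ v ∉ S₀, Algebra.IsUnramifiedIn (𝓞 L) v.asIdeal) : ρ.UnramTraceOneHOff S₀ νH :=
  UnramTraceOneHOff.of_isUnramifiedIn h (fun v => by rw [measureReal_def, ← Subgroup.coe_prod, hKH v, ENNReal.toReal_one]) hS₀

/-- **(TF-1)-H∕S₀ FOR ANY `S₀ ⊇ RamL`, FROM (KH3′)♭ + `vol(K_{H,v}) = 1`** — the instance the junction reads at `S₀ := Sψ ∪ S₉ ∪ RamL` (its (T)-slot functional is then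
`ρ.trHOn S₀ νH archTrH`). [cite: Rogawski1990, §13.3 p. 203 l. 1–3; §4.3 p. 44; §4.5 p. 49] -/
theorem UnramTraceOneHOff.of_isUnramifiedIn_of_ramified_subset
    (h : ∀ v : HeightOneSpectrum (𝓞 ↥(maximalRealSubfield L)), Algebra.IsUnramifiedIn (𝓞 L) v.asIdeal → (𝔩 v).unr ((𝔩 v).xiH (ρ.fin.loc v)) →
      ρ.trFinAt v (νH v) ((((cmLocalIntegralLevel L 2 (splitForm L 2) v : Set ((cmDatum L 2 (splitForm L 2)).Local v)) ×ˢ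
        (cmLocalIntegralLevel L 1 (splitForm L 1) v : Set ((cmDatum L 1 (splitForm L 1)).Local v)))).indicator fun _ => 1) =
        (νH v).real (((cmLocalIntegralLevel L 2 (splitForm L 2) v : Set ((cmDatum L 2 (splitForm L 2)).Local v)) ×ˢ
          (cmLocalIntegralLevel L 1 (splitForm L 1) v : Set ((cmDatum L 1 (splitForm L 1)).Local v)))))
    (hvolH : ∀ v : HeightOneSpectrum (𝓞 ↥(maximalRealSubfield L)),
      (νH v).real (((cmLocalIntegralLevel L 2 (splitForm L 2) v : Set ((cmDatum L 2 (splitForm L 2)).Local v)) ×ˢ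
        (cmLocalIntegralLevel L 1 (splitForm L 1) v : Set ((cmDatum L 1 (splitForm L 1)).Local v)))) = 1)
    (hS₀ : (Literature.NumberTheory.GaloisRepresentations.finite_setOf_not_isUnramifiedIn ↥(maximalRealSubfield L) L).toFinset ⊆ S₀) :
    ρ.UnramTraceOneHOff S₀ νH :=
  UnramTraceOneHOff.of_isUnramifiedIn h hvolH fun _ hv => isUnramifiedIn_of_not_mem_of_ramified_subset hS₀ hv

/-- **… and with the witness's ENNReal normalisation text** (the junction's `hvolH` VERBATIM). [cite: Rogawski1990, §13.3 p. 203 l. 1–3; §4.3 p. 44; §4.5 p. 49] -/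
theorem UnramTraceOneHOff.of_isUnramifiedIn_of_prod_of_ramified_subset
    (h : ∀ v : HeightOneSpectrum (𝓞 ↥(maximalRealSubfield L)), Algebra.IsUnramifiedIn (𝓞 L) v.asIdeal → (𝔩 v).unr ((𝔩 v).xiH (ρ.fin.loc v)) →
      ρ.trFinAt v (νH v) ((((cmLocalIntegralLevel L 2 (splitForm L 2) v : Set ((cmDatum L 2 (splitForm L 2)).Local v)) ×ˢ
        (cmLocalIntegralLevel L 1 (splitForm L 1) v : Set ((cmDatum L 1 (splitForm L 1)).Local v)))).indicator fun _ => 1) =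
        (νH v).real (((cmLocalIntegralLevel L 2 (splitForm L 2) v : Set ((cmDatum L 2 (splitForm L 2)).Local v)) ×ˢ
          (cmLocalIntegralLevel L 1 (splitForm L 1) v : Set ((cmDatum L 1 (splitForm L 1)).Local v)))))
    (hKH : ∀ v : HeightOneSpectrum (𝓞 ↥(maximalRealSubfield L)),
      νH v (((cmLocalIntegralLevel L 2 (Matrix.of fun i j : Fin 2 => if i.val + j.val + 1 = 2 then (1 : L) else 0) v).prod
          (cmLocalIntegralLevel L 1 (Matrix.of fun i j : Fin 1 => if i.val + j.val + 1 = 1 then (1 : L) else 0) v) :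
            Subgroup ((cmDatum L 2 (splitForm L 2)).Local v × (cmDatum L 1 (splitForm L 1)).Local v)) :
          Set ((cmDatum L 2 (splitForm L 2)).Local v × (cmDatum L 1 (splitForm L 1)).Local v)) = 1)
    (hS₀ : (Literature.NumberTheory.GaloisRepresentations.finite_setOf_not_isUnramifiedIn ↥(maximalRealSubfield L) L).toFinset ⊆ S₀) :
    ρ.UnramTraceOneHOff S₀ νH :=
  UnramTraceOneHOff.of_isUnramifiedIn_of_prod h hKH fun _ hv => isUnramifiedIn_of_not_mem_of_ramified_subset hS₀ hv

end SpectralPacketH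

end Summit.HodgeConjecture.HodgeConjecture.Cruxes.H413.F0P3SpectralPacket

end
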